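import Mathlib
import HarnessLib
import Summits.HubbardSuperconductivity.HubbardSuperconductivity.Theorems.KLProgrammeLatticeForwardBubble
import Summits.HubbardSuperconductivity.HubbardSuperconductivity.Theorems.KLProgrammeLatticePeriodicExtensionQuasi

/-!
# Route `KLProgramme` — ENGINE stmt-HubbardSuperconductivity-20437 `KLRegimeEngineV17F2`, row (c) value lane / class-#5 STEP (X).3 pinned pair: CELLS ⇒ RAYS — per-ray
# quasi-Lipschitz data of the global McShane extension from ANGULAR-CELL lattice data (brick (L3)-5 of cure (A″) route 3′ of located «(c)-OUT-COOPER-ANTIPODE»; cell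
# gate-hubbard-kl, seat hubbard-kl-k3c2-p2 g26, technique «thermal-bar induction n ≤ nScales β + 1 with EngineBoundsAtV4S sums»)

WHY.  The lattice lemmas `klfl_*TC_cellsSq` (…LatticeSoftBubbleSharpTCCellsSq) ask, for `θ ∈ (−π, π)` and ray points `t·dir θ` INSIDE THE OPEN SQUARE on the tube segment
`|E(t·dir θ)| < 4Λₙ`, a quasi-Lipschitz datum `‖a(t·dir θ) − a(t'·dir θ)‖ ≤ A₁(θ)|t − t'| + δ_A(θ)` of the planar weight `a = klpeExt Y A₀ K_g` (global McShane extension of the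
lattice pin `Y`, `K_g` its global torus-Lipschitz constant — any size).  This file derives that datum from CELL data of `Y` in the producer-facing form of CELL-SIGNATURES.md: a finite
family of ANGULAR CELLS `c` — an arc `[α_c, β_c]` of ray angles, a finite set `S_c` of lattice momenta SERVING the arc (every lattice momentum within torus sup-distance `r` of the
frame's Fermi point `F_θ`, `θ ∈ [α_c, β_c]`, lies in `S_c`; `r ≥ 4Λₙ/(Dt_min − κ₁) + π/L`), and a Lipschitz constant `Lc_c` of `Y` ON `S_c`; the arcs cover `(−π, π)`.
GEOMETRY: a square ray point in the tube lies within `|t − u_E(θ)| ≤ 4Λₙ/(Dt_min − κ₁)` of the Fermi radius (growth of the perturbed ray dispersion, `klrf_growth`), so all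
lattice momenta at torus distance `≤ π/L` of it are within `r` of `F_θ`, i.e. in the serving cell, and `klpe_ext_quasi_lipschitz_of_cell` applies:
`A₁(θ) = Σ_c 1_{[α_c,β_c]}(θ)·Lc_c`, `δ_A(θ) = Σ_c 1_{[α_c,β_c]}(θ)·(2Lc_c + 4K_g)·π/L` — finite indicator sums of INTERVALS: measurable, integrable, with
`∫ A₁ ≤ Σ_c Lc_c·(β_c − α_c)`, `∫ δ_A ≤ Σ_c (2Lc_c + 4K_g)(π/L)(β_c − α_c)` (the producer's currencies are on these arc-weighted sums; the antipodal cell of angular width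
`∝ Λₙ` may carry `Lc ∝ 1/Λₙ`).
* §1 the profiles `klcrA1`, `klcrδA`: nonnegativity, domination of each served cell's constant, integrability, integral bounds;
* §2 `klcr_abs_sub_radius_le` (square tube points sit within `ē/(Dt_min − κ₁)` of the perturbed Fermi radius), `klcr_tau_sub_fermiPt_le`;
* §3 **`klcr_ext_ray_quasi_of_cells`** — the per-ray hypothesis `haq` of `klfl_*TC_cellsSq`, from cells.
Pure analysis/geometry on the tree's objects; nothing about the model is asserted; nothing asserts (X).3, (c), K3 or superconductivity.  0 kit · 0 lit.
-/

noncomputable section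

namespace Summit.HubbardSuperconductivity.HubbardSuperconductivity.Theorems.KLRegimeSplit

set_option linter.dupNamespace false -- summit = problem name (single-conjunct summit), D-0017

open Real Set MeasureTheory Literature.MathematicalPhysics.QuantumLattice
open Literature.Probability.LatticeModels hiding torusSupNorm
open Literature.MathematicalPhysics.QuantumLattice.BandSectorCounting
open Summit.HubbardSuperconductivity.HubbardSuperconductivity.Theorems.PerturbedFermiCurve
open Summit.HubbardSuperconductivity.HubbardSuperconductivity.Theorems.KLProgrammeLegKernels
open Summit.HubbardSuperconductivity.HubbardSuperconductivity.Theorems.EngineV8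
open scoped BigOperators

/-! ## §1 The angle profiles of an angular-cell family -/

section Profiles

variable {ι : Type*} [Fintype ι]

/-- **Per-ray Lipschitz profile** of an angular-cell family: `A₁(θ) = Σ_c 1_{[α_c, β_c]}(θ)·Lc_c`. -/
def klcrA1 (αc βc Lc : ι → ℝ) (θ : ℝ) : ℝ := ∑ c, (Icc (αc c) (βc c)).indicator (fun _ => Lc c) θ

/-- **Per-ray defect profile**: `δ_A(θ) = Σ_c 1_{[α_c, β_c]}(θ)·(2Lc_c + 4K_g)·(π/L)`. -/
def klcrδA (αc βc Lc : ι → ℝ) (Kg : ℝ) (L : ℕ) (θ : ℝ) : ℝ :=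
  ∑ c, (Icc (αc c) (βc c)).indicator (fun _ => (2 * Lc c + 4 * Kg) * (Real.pi / L)) θ

omit [Fintype ι] in
/-- A constant nonnegative indicator is nonnegative. -/
theorem klcr_indicator_const_nonneg {s : Set ℝ} {C : ℝ} (hC : 0 ≤ C) (θ : ℝ) : 0 ≤ s.indicator (fun _ => C) θ := by
  by_cases h : θ ∈ s
  · rw [Set.indicator_of_mem h]; exact hC
  · rw [Set.indicator_of_notMem h]

/-- `0 ≤ A₁(θ)`. -/
theorem klcrA1_nonneg {αc βc Lc : ι → ℝ} (hLc : ∀ c, 0 ≤ Lc c) (θ : ℝ) : 0 ≤ klcrA1 αc βc Lc θ :=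
  Finset.sum_nonneg fun c _ => klcr_indicator_const_nonneg (hLc c) θ

/-- `0 ≤ δ_A(θ)`. -/
theorem klcrδA_nonneg {αc βc Lc : ι → ℝ} (hLc : ∀ c, 0 ≤ Lc c) {Kg : ℝ} (hKg : 0 ≤ Kg) (L : ℕ) (θ : ℝ) : 0 ≤ klcrδA αc βc Lc Kg L θ :=
  Finset.sum_nonneg fun c _ => klcr_indicator_const_nonneg (by have := hLc c; positivity) θ

/-- A served cell's constant is dominated by the profile: `θ ∈ [α_c, β_c] ⇒ Lc_c ≤ A₁(θ)`. -/
theorem le_klcrA1_of_mem {αc βc Lc : ι → ℝ} (hLc : ∀ c, 0 ≤ Lc c) {c : ι} {θ : ℝ} (hθ : θ ∈ Icc (αc c) (βc c)) :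
    Lc c ≤ klcrA1 αc βc Lc θ := by
  unfold klcrA1
  have h := Finset.single_le_sum (f := fun c' => (Icc (αc c') (βc c')).indicator (fun _ => Lc c') θ)
    (fun c' _ => klcr_indicator_const_nonneg (hLc c') θ) (Finset.mem_univ c)
  rwa [Set.indicator_of_mem hθ] at h

/-- `θ ∈ [α_c, β_c] ⇒ (2Lc_c + 4K_g)·π/L ≤ δ_A(θ)`. -/
theorem le_klcrδA_of_mem {αc βc Lc : ι → ℝ} (hLc : ∀ c, 0 ≤ Lc c) {Kg : ℝ} (hKg : 0 ≤ Kg) (L : ℕ) {c : ι} {θ : ℝ}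
    (hθ : θ ∈ Icc (αc c) (βc c)) : (2 * Lc c + 4 * Kg) * (Real.pi / L) ≤ klcrδA αc βc Lc Kg L θ := by
  unfold klcrδA
  have h := Finset.single_le_sum (f := fun c' => (Icc (αc c') (βc c')).indicator (fun _ => (2 * Lc c' + 4 * Kg) * (Real.pi / L)) θ)
    (fun c' _ => klcr_indicator_const_nonneg (by have := hLc c'; positivity) θ) (Finset.mem_univ c)
  rwa [Set.indicator_of_mem hθ] at h

omit [Fintype ι] in
/-- A constant indicator of an interval is integrable on `(−π, π)`. -/
theorem klcr_integrableOn_indicator_const (α β C : ℝ) : IntegrableOn (fun θ => (Icc α β).indicator (fun _ => C) θ) (Ioo (-π) π) := by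
  have hvol : volume (Ioo (-π) π) < ⊤ := by rw [Real.volume_Ioo]; exact ENNReal.ofReal_lt_top
  exact ((integrableOn_const (hs := hvol.ne) (C := C)).indicator measurableSet_Icc)

/-- `A₁` is integrable on `(−π, π)`. -/
theorem klcrA1_integrableOn (αc βc Lc : ι → ℝ) : IntegrableOn (klcrA1 αc βc Lc) (Ioo (-π) π) := by
  have h : IntegrableOn (fun θ => ∑ c, (Icc (αc c) (βc c)).indicator (fun _ => Lc c) θ) (Ioo (-π) π) :=
    integrable_finsetSum (s := Finset.univ) fun c _ => klcr_integrableOn_indicator_const (αc c) (βc c) (Lc c)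
  exact h

/-- `δ_A` is integrable on `(−π, π)`. -/
theorem klcrδA_integrableOn (αc βc Lc : ι → ℝ) (Kg : ℝ) (L : ℕ) : IntegrableOn (klcrδA αc βc Lc Kg L) (Ioo (-π) π) := by
  have h : IntegrableOn (fun θ => ∑ c, (Icc (αc c) (βc c)).indicator (fun _ => (2 * Lc c + 4 * Kg) * (Real.pi / L)) θ) (Ioo (-π) π) :=
    integrable_finsetSum (s := Finset.univ) fun c _ => klcr_integrableOn_indicator_const (αc c) (βc c) _
  exact h

omit [Fintype ι] in
/-- `∫_{(−π,π)} C·1_{[α,β]} ≤ C·(β − α)`. -/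
theorem klcr_integral_indicator_const_le {α β C : ℝ} (hαβ : α ≤ β) (hC : 0 ≤ C) :
    ∫ θ in Ioo (-π) π, (Icc α β).indicator (fun _ => C) θ ≤ C * (β - α) := by
  rw [integral_indicator_const (e := C) measurableSet_Icc, smul_eq_mul, mul_comm]
  refine mul_le_mul_of_nonneg_left ?_ hC
  rw [Measure.real, Measure.restrict_apply measurableSet_Icc]
  calc ((volume : Measure ℝ) (Icc α β ∩ Ioo (-π) π)).toReal ≤ ((volume : Measure ℝ) (Icc α β)).toReal :=
        ENNReal.toReal_mono (by rw [Real.volume_Icc]; exact ENNReal.ofReal_ne_top) (measure_mono Set.inter_subset_left)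
    _ = β - α := by rw [Real.volume_Icc, ENNReal.toReal_ofReal (by linarith)]

/-- **Arc-weighted integral bound**: `∫_{(−π,π)} A₁ ≤ Σ_c Lc_c·(β_c − α_c)`. -/
theorem integral_klcrA1_le {αc βc Lc : ι → ℝ} (hαβ : ∀ c, αc c ≤ βc c) (hLc : ∀ c, 0 ≤ Lc c) :
    ∫ θ in Ioo (-π) π, klcrA1 αc βc Lc θ ≤ ∑ c, Lc c * (βc c - αc c) := by
  unfold klcrA1
  rw [integral_finsetSum _ (fun c _ => klcr_integrableOn_indicator_const (αc c) (βc c) (Lc c))]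
  exact Finset.sum_le_sum fun c _ => klcr_integral_indicator_const_le (hαβ c) (hLc c)

/-- **Arc-weighted integral bound**: `∫_{(−π,π)} δ_A ≤ Σ_c (2Lc_c + 4K_g)·(π/L)·(β_c − α_c)`. -/
theorem integral_klcrδA_le {αc βc Lc : ι → ℝ} (hαβ : ∀ c, αc c ≤ βc c) (hLc : ∀ c, 0 ≤ Lc c) {Kg : ℝ} (hKg : 0 ≤ Kg) (L : ℕ) :
    ∫ θ in Ioo (-π) π, klcrδA αc βc Lc Kg L θ ≤ ∑ c, (2 * Lc c + 4 * Kg) * (Real.pi / L) * (βc c - αc c) := by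
  unfold klcrδA
  rw [integral_finsetSum _ (fun c _ => klcr_integrableOn_indicator_const (αc c) (βc c) _)]
  exact Finset.sum_le_sum fun c _ => klcr_integral_indicator_const_le (hαβ c) (by have := hLc c; positivity)

end Profiles

/-! ## §2 Geometry of the tube segment of a ray: localisation at the perturbed Fermi radius -/

section Geometry

variable {a b : ℝ} (B : BandBounds a b) {δ : (Fin 2 → ℝ) → ℝ} (hδ1 : ContDiff ℝ 1 δ) {κ₀ κ₁ : ℝ}
  (hδ : ∀ k : Fin 2 → ℝ, (∀ i, |k i| ≤ π) → |δ k| ≤ κ₀)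
  (hκ : ∀ k : Fin 2 → ℝ, (∀ i, |k i| ≤ π) → ‖fderiv ℝ δ k‖ ≤ κ₁) (hκ₁ : κ₁ < B.Dtmin)

include B hδ1 hδ hκ hκ₁ in
/-- **A square ray point in the tube `|band| < ē` sits within `ē/(Dt_min − κ₁)` of the perturbed Fermi radius**: for `t ≥ 0` with `|t cos θ|, |t sin θ| < π` and
`|ε₀(t·dir θ) + δ(t·dir θ) − μ| < ē` (margin window `a ≤ μ − ē − κ₀`, `μ + ē + κ₀ ≤ b`): `|t − u_E(θ)| ≤ ē/(Dt_min − κ₁)`. -/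
theorem klcr_abs_sub_radius_le {μ ē : ℝ} (hlo : a ≤ μ - ē - κ₀) (hhi : μ + ē + κ₀ ≤ b) (hē : 0 ≤ ē)
    {θ t : ℝ} (ht : 0 ≤ t) (h1 : |t * Real.cos θ| < π) (h2 : |t * Real.sin θ| < π)
    (hb : |klfb_band δ μ (t * Real.cos θ, t * Real.sin θ)| < ē) :
    |t - perturbedFermiRadius δ μ θ| ≤ ē / (B.Dtmin - κ₁) := by
  have hδc : Continuous δ := hδ1.continuous
  have hκ₀ : 0 ≤ κ₀ := (abs_nonneg _).trans (hδ 0 (fun i => by simp [Real.pi_pos.le]))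
  have hμlo : a ≤ μ - κ₀ := by linarith
  have hμhi : μ + κ₀ ≤ b := by linarith
  have hDt : 0 < B.Dtmin - κ₁ := by linarith
  set u := perturbedFermiRadius δ μ θ with hu
  have hR : IsBandFermiRadius (μ - δ (u • dir θ)) θ u := isBandFermiRadius_perturbedFermiRadius B hδc hδ hμlo hμhi θ
  have hm := shiftedLevel_perturbedFermiRadius_mem_Icc B hδc hδ hμlo hμhi θ
  -- the band value of the ray point in the ray-dispersion spelling
  have hband : klfb_band δ μ (t * Real.cos θ, t * Real.sin θ) = rayDispersion (θ, t) + δ (t • dir θ) - μ := by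
    unfold klfb_band
    rw [klrf_vec_ray]
    rfl
  rw [hband] at hb
  have hb' := abs_lt.mp hb
  -- `t` lies on the segment, in the closed square
  have h1' : |t| * |Real.cos θ| < π := by simpa [abs_mul] using h1
  have h2' : |t| * |Real.sin θ| < π := by simpa [abs_mul] using h2
  have hsq : ∀ i, |(t • dir θ) i| ≤ π := by
    intro i
    fin_cases i
    · simpa [dir, smul_eq_mul, abs_mul] using h1'.le
    · simpa [dir, smul_eq_mul, abs_mul] using h2'.le
  have htπ : t * ‖dir θ‖ ≤ π := by
    rw [norm_dir]
    rw [abs_of_nonneg ht] at h1' h2'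
    rcases le_total |Real.cos θ| |Real.sin θ| with hcs | hcs
    · rw [max_eq_right hcs]; exact h2'.le
    · rw [max_eq_left hcs]; exact h1'.le
  -- the free level of `t` lies in `[a, b]`
  have hδt := abs_le.mp (hδ _ hsq)
  have hat : a ≤ rayDispersion (θ, t) := by linarith [hδt.2]
  have htb : rayDispersion (θ, t) ≤ b := by linarith [hδt.1]
  rw [le_div_iff₀ hDt]
  rcases le_total t u with htu | hut
  · have hg := klrf_growth B hδ1 hκ ht htu hR.1.2 hat (by rw [hR.2]; exact hm.2)
    rw [hR.2] at hg
    rw [abs_of_nonpos (sub_nonpos.mpr htu)]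
    nlinarith
  · have hg := klrf_growth B hδ1 hκ hR.1.1 hut htπ (by rw [hR.2]; exact hm.1) htb
    rw [hR.2] at hg
    rw [abs_of_nonneg (sub_nonneg.mpr hut)]
    nlinarith

include B hδ1 hδ hκ hκ₁ in
/-- **Torus distance from a square tube point to the frame's Fermi point of its ray**: `|t·dir θ − u_E(θ)·dir θ|_𝕋 ≤ ē/(Dt_min − κ₁)`. -/
theorem klcr_tau_sub_fermiPt_le {μ ē : ℝ} (hlo : a ≤ μ - ē - κ₀) (hhi : μ + ē + κ₀ ≤ b) (hē : 0 ≤ ē)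
    {θ t : ℝ} (ht : 0 ≤ t) (h1 : |t * Real.cos θ| < π) (h2 : |t * Real.sin θ| < π)
    (hb : |klfb_band δ μ (t * Real.cos θ, t * Real.sin θ)| < ē) :
    torusSupNorm ((t * Real.cos θ, t * Real.sin θ) -
        (perturbedFermiRadius δ μ θ * Real.cos θ, perturbedFermiRadius δ μ θ * Real.sin θ)) ≤ ē / (B.Dtmin - κ₁) :=
  ((klpe_tau_sub_le_dist _ _).trans (klfl_dist_ray_le θ t _)).trans (klcr_abs_sub_radius_le B hδ1 hδ hκ hκ₁ hlo hhi hē ht h1 h2 hb)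

end Geometry


/-! ## §3 Cells ⇒ rays -/

section Cells

variable {a b : ℝ} (B : BandBounds a b) {δ : (Fin 2 → ℝ) → ℝ} (hδ1 : ContDiff ℝ 1 δ) {κ₀ κ₁ : ℝ}
  (hδ : ∀ k : Fin 2 → ℝ, (∀ i, |k i| ≤ π) → |δ k| ≤ κ₀)
  (hκ : ∀ k : Fin 2 → ℝ, (∀ i, |k i| ≤ π) → ‖fderiv ℝ δ k‖ ≤ κ₁) (hκ₁ : κ₁ < B.Dtmin)

include B hδ1 hδ hκ hκ₁ in
/-- **CELLS ⇒ RAYS.**  Frame band `ε₀ + δ − μ` (p4's hypotheses, margin window at `ē = 4Λₙ`); lattice pin `Y : TorusSite 2 L → ℂ` with sup `A₀` and GLOBAL torus-Lipschitz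
constant `K_g ≥ 0`; a finite family of ANGULAR CELLS `c : ι` — arcs `[α_c, β_c]`, serving sets `S_c` (every lattice momentum within torus sup-distance `r` of the Fermi point
`u_E(θ)·dir θ`, `θ ∈ [α_c, β_c]`, lies in `S_c`; `r ≥ 4Λₙ/(Dt_min − κ₁) + π/L`) and cell Lipschitz constants `Lc_c ≥ 0` of `Y` on `S_c`; the arcs cover `(−π, π)`.  Then the
global McShane extension `a = klpeExt Y A₀ K_g` satisfies the per-ray hypothesis `haq` of `klfl_*TC_cellsSq`: for `θ ∈ (−π, π)` and square ray points `t·dir θ`, `t'·dir θ` in the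
tube `|band| < 4Λₙ`, `‖a(t·dir θ) − a(t'·dir θ)‖ ≤ A₁(θ)|t − t'| + δ_A(θ)` with the profiles `klcrA1`, `klcrδA` of §1. -/
theorem klcr_ext_ray_quasi_of_cells {μ : ℝ} {n : ℕ} (hlo : a < μ - 4 * klScale klE0 n - κ₀) (hhi : μ + 4 * klScale klE0 n + κ₀ < b)
    {L : ℕ} [NeZero L] {Y : TorusSite 2 L → ℂ} {A₀ Kg : ℝ} (hKg : 0 ≤ Kg)
    (hY0 : ∀ k, ‖Y k‖ ≤ A₀) (hY1 : ∀ k k', ‖Y k - Y k'‖ ≤ Kg * klTorusNorm L (k - k'))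
    {ι : Type*} [Fintype ι] {S : ι → Finset (TorusSite 2 L)} {αc βc Lc : ι → ℝ} (hLc : ∀ c, 0 ≤ Lc c)
    {r : ℝ} (hr : 4 * klScale klE0 n / (B.Dtmin - κ₁) + Real.pi / L ≤ r)
    (hserve : ∀ c, ∀ θ ∈ Icc (αc c) (βc c), ∀ k : TorusSite 2 L,
      torusSupNorm (klpeP L k - (perturbedFermiRadius δ μ θ * Real.cos θ, perturbedFermiRadius δ μ θ * Real.sin θ)) ≤ r → k ∈ S c)
    (hcell : ∀ c, ∀ k ∈ S c, ∀ k' ∈ S c, ‖Y k - Y k'‖ ≤ Lc c * klTorusNorm L (k - k'))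
    (hcover : ∀ θ ∈ Ioo (-π) π, ∃ c, θ ∈ Icc (αc c) (βc c)) :
    ∀ θ ∈ Ioo (-π) π, ∀ t t' : ℝ, 0 ≤ t → 0 ≤ t' →
      |t * Real.cos θ| < π → |t * Real.sin θ| < π → |t' * Real.cos θ| < π → |t' * Real.sin θ| < π →
      |klfb_band δ μ (t * Real.cos θ, t * Real.sin θ)| < 4 * klScale klE0 n →
      |klfb_band δ μ (t' * Real.cos θ, t' * Real.sin θ)| < 4 * klScale klE0 n →
      ‖klpeExt Y A₀ Kg (t * Real.cos θ, t * Real.sin θ) - klpeExt Y A₀ Kg (t' * Real.cos θ, t' * Real.sin θ)‖ ≤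
        klcrA1 αc βc Lc θ * |t - t'| + klcrδA αc βc Lc Kg L θ := by
  intro θ hθ t t' ht ht' h1 h2 h1' h2' hb hb'
  obtain ⟨c, hc⟩ := hcover θ hθ
  have hΛ := klth_klScale_pos n
  have hDt : 0 < B.Dtmin - κ₁ := by linarith
  set F : ℝ × ℝ := (perturbedFermiRadius δ μ θ * Real.cos θ, perturbedFermiRadius δ μ θ * Real.sin θ) with hF
  set p : ℝ × ℝ := (t * Real.cos θ, t * Real.sin θ) with hp
  set q : ℝ × ℝ := (t' * Real.cos θ, t' * Real.sin θ) with hq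
  have hē : (0 : ℝ) ≤ 4 * klScale klE0 n := by positivity
  have hpF : torusSupNorm (p - F) ≤ 4 * klScale klE0 n / (B.Dtmin - κ₁) :=
    klcr_tau_sub_fermiPt_le B hδ1 hδ hκ hκ₁ hlo.le hhi.le hē ht h1 h2 hb
  have hqF : torusSupNorm (q - F) ≤ 4 * klScale klE0 n / (B.Dtmin - κ₁) :=
    klcr_tau_sub_fermiPt_le B hδ1 hδ hκ hκ₁ hlo.le hhi.le hē ht' h1' h2' hb'
  -- every lattice momentum near a tube point of the ray is served by the cell `c`
  have hserv : ∀ x : ℝ × ℝ, torusSupNorm (x - F) ≤ 4 * klScale klE0 n / (B.Dtmin - κ₁) →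
      ∀ k : TorusSite 2 L, torusSupNorm (x - klpeP L k) ≤ Real.pi / L → k ∈ S c := by
    intro x hx k hk
    refine hserve c θ hc k ?_
    have htri : torusSupNorm (klpeP L k - F) ≤ torusSupNorm (klpeP L k - x) + torusSupNorm (x - F) := by
      have h := klpe_tau_add_le (klpeP L k - x) (x - F); rwa [sub_add_sub_cancel] at h
    have e1 : torusSupNorm (klpeP L k - x) = torusSupNorm (x - klpeP L k) := by rw [← neg_sub, klpe_tau_neg]
    rw [e1] at htri
    linarith
  have hE := klpe_ext_quasi_lipschitz_of_cell (B := A₀) hKg (hLc c) hY0 hY1 (hcell c) (hserv p hpF) (hserv q hqF)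
  have hpq : torusSupNorm (p - q) ≤ |t - t'| := (klpe_tau_sub_le_dist p q).trans (klfl_dist_ray_le θ t t')
  calc ‖klpeExt Y A₀ Kg p - klpeExt Y A₀ Kg q‖ ≤ Lc c * torusSupNorm (p - q) + (2 * Lc c + 4 * Kg) * (Real.pi / L) := hE
    _ ≤ Lc c * |t - t'| + (2 * Lc c + 4 * Kg) * (Real.pi / L) := by
        have := hLc c; nlinarith
    _ ≤ klcrA1 αc βc Lc θ * |t - t'| + klcrδA αc βc Lc Kg L θ :=
        add_le_add (mul_le_mul_of_nonneg_right (le_klcrA1_of_mem hLc hc) (abs_nonneg _)) (le_klcrδA_of_mem hLc hKg L hc)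

end Cells

end Summit.HubbardSuperconductivity.HubbardSuperconductivity.Theorems.KLRegimeSplit

end
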